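import Summits.CriticalPhenomena.PercolationContinuityZ3.Theorems.PercNearOneGluingNoHeavyLowerTailCILRelayNeighboursHolds
import HarnessLib

/-!
# `NoHeavyLowerTail` (stmt-CriticalPhenomena-4575) — CIL for relay-neighboured observers: the witness is a PORT,
# and every relay dominating the ports IN THE GRAPH ITSELF is a valid witness

Support file (lead `prim-nh-lead-4575`, gen 1; `--supports stmt-CriticalPhenomena-4575`).  No definitions, no named facts,
no sorries.

`Theorems.cil_relayNeighbours` (prover `prim-gen-induct`) proves the cumulative isolation lemma CIL_j for an observer `o ∉ A`
all of whose positive-weight neighbours are relays (the ports `p 0, …, p (d−1)`), with conclusion `∃ a ∈ A, μ{1 ≤ N ≤ j} ≤ μ{|π(a)| ≤ j}`.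
Its proof produces a PORT as the witness (the port whose cluster in `G − o` is most often light).  This file records the two
consequences the lead's hull-port programme (`LEAD-GEN1.md`, crux evidence) uses:

* `cil_relayNeighbours_port` — the same theorem with the conclusion `∃ i, μ{1 ≤ N ≤ j} ≤ μ{|π(p i)| ≤ j}`: SOME PORT is a valid
  CIL witness (the `𝓗 = {o}` case of the conjectured "best hull port is a valid witness", crux evidence LEAD-GEN1.md §1 (Ψ)).
* `cil_of_portDomination` — the SELF-REFERENCED relay-port CIL: if a relay `b` is at least as often light as every port, the
  lightness being measured in the graph `G` ITSELF (edges at `o` included, not in `G − o` as in the landed witness rule), then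
  `μ{1 ≤ N ≤ j} ≤ μ{|π(b)| ≤ j}`.  Proof: `b` dominates in particular the valid port of `cil_relayNeighbours_port`.  (Numerically the
  reference graph matters — domination measured in `G − 𝓗` or with the weights at `o` increased does NOT imply validity — but both
  `G − o` and `G` are sound references; this is the `G` half.)
-/

noncomputable section

namespace Summit.CriticalPhenomena.PercolationContinuityZ3.Theorems

open MeasureTheory Set Literature.Probability.LatticeModels Literature.Probability.Percolation
open scoped Classical BigOperators

variable {n : ℕ}

open CutObserver in
/-- **CIL for a relay-neighboured observer, with a PORT as witness.**  Let `o ∉ A` and let every positive-weight neighbour of `o`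
be one of the relays `p 0, …, p (d−1) ∈ A` (`p` injective, `d ≥ 1`); the weighted graph is otherwise arbitrary.  Then for every
level `j` some PORT `p i` satisfies `μ{1 ≤ N ≤ j} ≤ μ{|π(p i)| ≤ j}`.  Witness: the port whose cluster without the edges at `o` is
most often light (as in `Theorems.cil_relayNeighbours`, whose proof this repeats with the port made explicit).
[cite: VandenbergHaggstromKahn2005, Thm. 1.5 — the only probabilistic input, via `CutObserver.portComparison_of_separation`] -/
theorem cil_relayNeighbours_port (w : Sym2 (Fin n) → unitInterval) (A : Finset (Fin n)) (o : Fin n) (j : ℕ) {d : ℕ}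
    (p : Fin d → Fin n) (hp : Function.Injective p) (hpA : ∀ l, p l ∈ A) (hoA : o ∉ A) (hd : 0 < d)
    (hobs : ∀ v, w s(o, v) ≠ 0 → ∃ l, v = p l) :
    ∃ i : Fin d,
      (prodBernoulli w).real {ω : BondConfig (Fin n) |
          1 ≤ (A.filter fun x => ω ∈ openConn o x).card ∧ (A.filter fun x => ω ∈ openConn o x).card ≤ j} ≤
        (prodBernoulli w).real {ω : BondConfig (Fin n) | (A.filter fun x => ω ∈ openConn (p i) x).card ≤ j} := by
  set sH : Fin d → ℝ := fun m => (prodBernoulli w).real {ω : BondConfig (Fin n) |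
    (A.filter fun x => (openGraph (ω ∩ {e | o ∉ e})).Reachable (p m) x).card ≤ j} with hsH
  obtain ⟨i, -, hi⟩ := Finset.exists_max_image Finset.univ sH ⟨⟨0, hd⟩, Finset.mem_univ _⟩
  refine ⟨i, cil_relayNeighbours_of_portComparison w A o j p hp hpA hoA hobs i ?_⟩
  intro l hli
  have key := portComparison_of_separation w A o j p hp (Ne.symm hli) (hi l (Finset.mem_univ _))
    (Finset.univ.filter fun m => l < m) {p l}
  have e : ∀ x : Fin d,
      {ω : BondConfig (Fin n) | ¬ (openGraph (ω ∩ {e | o ∉ e})).Reachable (p l) (p i)} ∩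
        {ω | ∀ m, l < m → (openGraph (ω ∩ {e | o ∉ e})).Reachable (p m) (p i) → s(o, p m) ∉ ω} ∩
        {ω | (A.filter fun y => (openGraph (ω ∩ {e | o ∉ e})).Reachable (p x) y).card ≤ j} =
      {ω : BondConfig (Fin n) | ∀ m ∈ (Finset.univ.filter fun m => l < m),
          (openGraph (ω ∩ {e | o ∉ e})).Reachable (p m) (p i) → s(o, p m) ∉ ω} ∩
        {ω | ∀ v ∈ ({p l} : Finset (Fin n)), ¬ (openGraph (ω ∩ {e | o ∉ e})).Reachable v (p i)} ∩
        {ω | (A.filter fun y => (openGraph (ω ∩ {e | o ∉ e})).Reachable (p x) y).card ≤ j} := by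
    intro x
    ext ω
    simp only [Finset.mem_filter, Finset.mem_univ, true_and, Finset.mem_singleton, forall_eq, mem_inter_iff,
      mem_setOf_eq]
    tauto
  rw [e l, e i]
  exact key

/-- **Self-referenced relay-port CIL.**  Let `o ∉ A` be relay-neighboured with ports `p 0, …, p (d−1)` (`p` injective, `d ≥ 1`,
every positive-weight neighbour of `o` a port).  If `b ∈ A` is at least as often light as every port — lightness `μ{|π(·)| ≤ j}`
measured in the graph itself — then `b` is a valid CIL witness: `μ{1 ≤ N ≤ j} ≤ μ{|π(b)| ≤ j}`.  Immediate from
`cil_relayNeighbours_port` (the valid port is dominated by `b`). [this file] -/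
theorem cil_of_portDomination (w : Sym2 (Fin n) → unitInterval) (A : Finset (Fin n)) (o : Fin n) (j : ℕ) {d : ℕ}
    (p : Fin d → Fin n) (hp : Function.Injective p) (hpA : ∀ l, p l ∈ A) (hoA : o ∉ A) (hd : 0 < d)
    (hobs : ∀ v, w s(o, v) ≠ 0 → ∃ l, v = p l) (b : Fin n)
    (hdom : ∀ l : Fin d,
      (prodBernoulli w).real {ω : BondConfig (Fin n) | (A.filter fun x => ω ∈ openConn (p l) x).card ≤ j} ≤
        (prodBernoulli w).real {ω : BondConfig (Fin n) | (A.filter fun x => ω ∈ openConn b x).card ≤ j}) :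
    (prodBernoulli w).real {ω : BondConfig (Fin n) |
        1 ≤ (A.filter fun x => ω ∈ openConn o x).card ∧ (A.filter fun x => ω ∈ openConn o x).card ≤ j} ≤
      (prodBernoulli w).real {ω : BondConfig (Fin n) | (A.filter fun x => ω ∈ openConn b x).card ≤ j} := by
  obtain ⟨i, hi⟩ := cil_relayNeighbours_port w A o j p hp hpA hoA hd hobs
  exact hi.trans (hdom i)

end Summit.CriticalPhenomena.PercolationContinuityZ3.Theorems

end
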